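import Summits.NavierStokesRegularity.NavierStokesRegularity.Theses.MarginalReynoldsCreep
import HarnessLib

/-!
# Birth skeleton — crux `NoLateRelaxation` (stmt-NavierStokesRegularity-17673, route MarginalReynoldsCreep;
# piece X₂ of the typed split of `NoBreathing`)

Line `hover-or-commit`: a sustained super-Type-I(M) episode (log-length `≥ L`, no Type-I(M) slice)
that later RELAXES (a Type-I(M) slice follows) must, along the way, either HOVER at intermediate
coupling or become INTENSE.  The two regimes are typed separately:

* `stub_noHovering` — the coupling cannot hover in `(M, H)`: for levels `M < H` there is a
  log-length `L₁(M,H)` such that, late, every stretch of log-length `≥ L₁` without Type-I(M)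
  slice contains a slice of height `≥ H` (`∃ r x, H ≤ (T-r)|u(r,x)|²`).  A consequence of
  `NoBreathing` (under which `R → ∞`), not of X₂; the hovering regime is the log-time analogue of
  the excluded DSS / time-periodic Leray profiles (Chae–Wolf 2017) with a drifting amplitude.
* `stub_noRelaxationAfterIntenseEpisode` — for every `M` there are `H(M) > M` and `L₃(M)` such
  that, late, an episode of log-length `≥ L₃` without Type-I(M) slice which reaches height `H`
  is never followed by a Type-I(M) slice (irreversibility of intense sustained episodes; X₂
  restricted to intense episodes — strictly weaker than X₂ by the intensity hypothesis, which
  `stub_noHovering` discharges).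
* `NoLateRelaxation_of` — PROVED: with `L = L₁ + L₃`, split an `L`-long super-M stretch
  `(s, t]` at `m = T - e^{-L₁}(T - s)`: `(s, m]` is `L₁`-long and dip-free, so it contains a slice
  of height `≥ H`; then `(s, t]` is `≥ L₃`-long, dip-free and intense, so no Type-I(M) slice
  follows `t`.
-/

noncomputable section

set_option linter.dupNamespace false
set_option linter.unusedVariables false

namespace Summit.NavierStokesRegularity.NavierStokesRegularity.Cruxes.NoLateRelaxation.Birth

open MeasureTheory Set Function Filter Topology
open Literature.Analysis.FluidPDE
open scoped ENNReal NNReal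

local notation "ℝ³" => EuclideanSpace ℝ (Fin 3)

/-- NO HOVERING — late, a stretch of log-length `≥ L₁(M,H)` without Type-I(M) slice reaches
height `H`. -/
theorem stub_noHovering :
    ∀ (ν T : ℝ), 0 < ν → 0 < T → ∀ (u : ℝ → ℝ³ → ℝ³) (p : ℝ → ℝ³ → ℝ),
      IsMaximalSmoothSolution ν 0 u p T → IsLerayHopfOn T ν 0 (u 0) u →
      HasRapidSpatialDecay (u 0) → ¬ IsTypeIBlowup u T →
      ∀ M H : ℝ, 0 < M → M < H → ∃ L₁ : ℝ, 0 < L₁ ∧ ∀ᶠ s in 𝓝[<] T,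
        ∀ t : ℝ, s < t → t < T → T - t ≤ Real.exp (-L₁) * (T - s) →
          (∀ r : ℝ, s < r → r ≤ t → ∃ x, M < (T - r) * ‖u r x‖ ^ 2) →
            ∃ r : ℝ, s < r ∧ r ≤ t ∧ ∃ x, H ≤ (T - r) * ‖u r x‖ ^ 2 := by
  sorry

/-- NO RELAXATION AFTER AN INTENSE SUSTAINED EPISODE — late, a stretch of log-length `≥ L₃(M)`
without Type-I(M) slice which reaches height `H(M)` is never followed by a Type-I(M) slice. -/
theorem stub_noRelaxationAfterIntenseEpisode :
    ∀ (ν T : ℝ), 0 < ν → 0 < T → ∀ (u : ℝ → ℝ³ → ℝ³) (p : ℝ → ℝ³ → ℝ),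
      IsMaximalSmoothSolution ν 0 u p T → IsLerayHopfOn T ν 0 (u 0) u →
      HasRapidSpatialDecay (u 0) → ¬ IsTypeIBlowup u T →
      ∀ M : ℝ, 0 < M → ∃ H L₃ : ℝ, M < H ∧ 0 < L₃ ∧ ∀ᶠ s in 𝓝[<] T,
        ∀ t : ℝ, s < t → t < T → T - t ≤ Real.exp (-L₃) * (T - s) →
          (∀ r : ℝ, s < r → r ≤ t → ∃ x, M < (T - r) * ‖u r x‖ ^ 2) →
            (∃ r : ℝ, s < r ∧ r ≤ t ∧ ∃ x, H ≤ (T - r) * ‖u r x‖ ^ 2) →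
              ∀ t' : ℝ, t ≤ t' → t' < T → ∃ x, M < (T - t') * ‖u t' x‖ ^ 2 := by
  sorry

/-- **Skeleton theorem: `NoLateRelaxation` from the two registered stubs** (real proof: split an
`(L₁+L₃)`-long super-M stretch at log-length `L₁`). -/
theorem NoLateRelaxation_of :
    Summit.NavierStokesRegularity.NavierStokesRegularity.Theses.MarginalReynoldsCreep.NoLateRelaxation := by
  intro ν T hν hT u p hmax hLH hdec hnI M hM
  obtain ⟨H, L₃, hMH, hL₃, hev3⟩ := stub_noRelaxationAfterIntenseEpisode ν T hν hT u p hmax hLH hdec hnI M hM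
  obtain ⟨L₁, hL₁, hev1⟩ := stub_noHovering ν T hν hT u p hmax hLH hdec hnI M H hM hMH
  refine ⟨L₁ + L₃, by positivity, ?_⟩
  filter_upwards [hev1, hev3] with s hs1 hs3
  intro t hst htT hlen hfree t' htt' ht'T
  have hTs : 0 < T - s := by linarith
  have he1 : Real.exp (-L₁) < 1 := by rw [Real.exp_lt_one_iff]; linarith
  have he1pos : 0 < Real.exp (-L₁) := Real.exp_pos _
  -- the split point `m = T - e^{-L₁}(T - s)`
  have hsm : s < T - Real.exp (-L₁) * (T - s) := by
    have : Real.exp (-L₁) * (T - s) < T - s := mul_lt_of_lt_one_left hTs he1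
    linarith
  have hmT : T - Real.exp (-L₁) * (T - s) < T := by
    have : 0 < Real.exp (-L₁) * (T - s) := mul_pos he1pos hTs
    linarith
  have hexp13 : Real.exp (-(L₁ + L₃)) ≤ Real.exp (-L₁) := Real.exp_le_exp.2 (by linarith)
  have hexp33 : Real.exp (-(L₁ + L₃)) ≤ Real.exp (-L₃) := Real.exp_le_exp.2 (by linarith)
  have hmt : T - Real.exp (-L₁) * (T - s) ≤ t := by
    have : T - t ≤ Real.exp (-L₁) * (T - s) :=
      hlen.trans (mul_le_mul_of_nonneg_right hexp13 hTs.le)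
    linarith
  have hTm : T - (T - Real.exp (-L₁) * (T - s)) = Real.exp (-L₁) * (T - s) := by ring
  -- no hovering on (s, m]: a slice of height ≥ H
  obtain ⟨r, hsr, hrm, x, hx⟩ := hs1 _ hsm hmT (le_of_eq hTm)
    (fun r hsr hrm => hfree r hsr (hrm.trans hmt))
  -- the whole stretch (s, t] is ≥ L₃ long, dip-free and intense
  have hlen3 : T - t ≤ Real.exp (-L₃) * (T - s) :=
    hlen.trans (mul_le_mul_of_nonneg_right hexp33 hTs.le)
  exact hs3 t hst htT hlen3 hfree ⟨r, hsr, hrm.trans hmt, x, hx⟩ t' htt' ht'T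

end Summit.NavierStokesRegularity.NavierStokesRegularity.Cruxes.NoLateRelaxation.Birth
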